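import Literature.MathematicalPhysics.QuantumFieldTheory.Balaban1983to89.B9SmoothHolderClassS
import Literature.MathematicalPhysics.QuantumFieldTheory.Balaban1983to89.B9GradViaDivLettersAtPinsHolderPairs

/-!
# `Balaban1983to89.B9SmoothHolderClassK` — THE SMOOTH-PARTITION HÖLDER CLASS OF THE BOND COORDINATE CARRIER: the twin of `B9SmoothHolderClassS.bHZ` on n06-d's
# bond carrier `XBK κ i = FBondY i × (Fin (d+1) × κ × κ)`, the partition of unity read through the SOURCE SITE of the fine bond — the target class of the gradient ∕
# transport letters `J_μ : sites → bonds` of rows 20–21 (`B9GradViaDivLettersAtPins.JcoKH`), member-uniform `κ = 1 + C_Lip(d, L)`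

T. Bałaban, *Propagators for lattice gauge theories in a background field*, Commun. Math. Phys. **99** (1985) 389–434
[`Balaban1985BackgroundPropagators`, "B9"]; [4] = T. Bałaban, *Propagators and renormalization transformations for lattice gauge
theories. II*, Commun. Math. Phys. **96** (1984) 223–250 [`Balaban1984PropagatorsII`].

statement-level skeleton of published theorems with citation tags; proofs where landed; nothing here is a claim about the
Yang–Mills mass gap

THE PRINTED LOCI.  [B9] p. 398 (remark after (3.47): *"λ replaced by a function J defined at bonds"*), (3.40) p. 397, (3.43)–(3.45) p. 398; [4] (2.137) p. 247
(the Hölder quotient on bond functions: same direction, *"|x − x′| ≦ 1"* at the scale `ξ`), (2.51)–(2.52) p. 232.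

WHY THIS FILE (cell `pub-ymgap`, node N06, seat dag-n06-l g20; fifth piece of the (F1) programme).  The free Hölder intermediates of rows 20–21 are read on TWO
carriers: site vectors (`XSK`, class `bHZ` of `B9SmoothHolderClassS`) and BOND vectors (`XBK`: the outputs of `J_μ`, `∇_U G₀ …`; n06-d's sharp class `bHK` of
`B9CoReadingCoordsInput`).  THIS FILE is the bond twin, with the same conventions: neighbourhoods `NearY i y (source site)`, near pairs = def-Y's ADMISSIBLE bond pairs
(`B6KLevelCensusIndexV1.Adm`: same direction, `|s − s′|_∞ ≤ L^{j}` both ways) that are distinct with the same coordinate slot, the η-scale pair weight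
`((|s − s′|_∞ ∕ Lᵏ)^ε)⁻¹`, the sup weight `Wscl p = (Lʲη)^{−p}` (`ε ≤ p`), the partition `zetaOn i srcY`, `Λ := C_Lip` — every structural binder discharged by
`B9MultiscaleSmoothPartitionY(Lip)` through the chart dictionary `torusSupNorm_chartY_sub` of `B9GradViaDivLettersAtPinsHolderPairs`.
CONTENT: §1 `srcY` (charted source site), `NearPairK`, `wEtaK` (+ `srcY_ne_of_nearPairK`, `torusSupNorm_srcY_pos`); §2 ★★ `bHZK i hε0 hε1 hεp : BlockNorm (toB6 (geo9K i) R H) (XBK κ i → ℝ)`,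
`bHZK_κ` (**`κ = 1 + CLip d ℓ`**, `rfl`), `bHZK_loc`, `bHZK_cut_apply`, `bHZK_isLoc_iff`, `bHZK_isLoc_of_blkV1` (a bond vector supported over the fine bonds of the carrier block `β y`
is localised at `y`).
HONEST SCOPE.  A definition by instantiation + `rfl`-level readings; the conventions are a proposal to the pin owner (dag-n06-d ∕ node00-def-Y), not a certificate edit; the
producers into the class (the `J`-letter, (3.43) for `∇_U G′`) are separate files; nothing of [B9]∕[4] asserted; COUNT-NEUTRAL; N06 NOT discharged; nothing continuum, nothing
about the mass gap.  Cell `pub-ymgap` (HUMAN RULING D-0062), Track A node N06 [B9], seat `pub-ymgap-dag-n06-l` (g20), 2026-08-28.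
-/

noncomputable section

namespace Literature.MathematicalPhysics.QuantumFieldTheory.Balaban1983to89.B9SmoothHolderClassK

open LatticeFieldCalculus (supDist)
open B4TorusKernel.MultiPeriod (torusSupNorm torusSupNorm_nonneg)
open B6MultiLevelTorusOperator (one_le_N0)
open B6Geom246MultiLevelBox (blkOf)
open B6GlobalChartV1 (PV blkV1)
open B6Ineq2142KLevelV1 (β lvl)
open B6KLevelCensusIndexV1 (KIdx Adm)
open B6Prop22KLevelTorusCensusEta (nKT one_le_nKT one_le_torusSupNorm_sub)
open B9GeoNormsKLevelV1 (geo9K)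
open B9Thm34Ext (toB6)
open B11SectG (BlockNorm)
open B11SectGGlobal (Size)
open B11SectGGlobalSizes
open B11SectGSmoothCut (ofSmoothPartition_loc ofSmoothPartition_cut_apply ofSmoothPartition_isLoc_iff)
open B9CoReadingCoords (XBK)
open B9CoReadingCoordsS (blkV1_site)
open B9GradViaDivLettersAtPinsHolderPairs (torusSupNorm_chartY_sub)
open B9MultiscaleSmoothPartitionY (scl scl_pos zeta NearY zetaOn sum_zetaOn_of_fintype zetaOn_nonneg zetaOn_le_one zetaOn_eq_zero_of_not_nearY nearY_of_blkOf_eq)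
open B9MultiscaleSmoothPartitionYLip (CLip CLip_nonneg scaledWeight_mul_abs_zeta_sub_le)
open B9SmoothHolderClassS (Wscl Wscl_nonneg Wscl_mono)
open Node00 (SiteY FBondY IBondY toKT)
open Node00.OpsYNablaBridge (chartY chartY_eq)

variable {d ℓ : ℕ} {hd : 1 ≤ d + 1} {hL : Odd (ℓ + 1) ∧ 1 < ℓ + 1} {b₀ b₁ : ℝ}
variable {κ : Type} [Fintype κ]

/-! ## §1 The source-site projection, the admissible pair domain and the weight -/

section Carrier

variable (i : KIdx d ℓ hd hL b₀ b₁)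

/-- the charted SOURCE SITE of the fine bond under a point of the bond coordinate carrier (the site projection through which the partition is read).
[cite: Balaban1985BackgroundPropagators, p.391 («A_μ(x) = A(x, x + ηe_μ)»), dictionary] -/
def srcY (p : XBK κ i) : SiteY i := chartY i p.1.src

/-- **NEAR PAIRS** of the bond coordinate carrier: distinct ADMISSIBLE bonds (def-Y's `Adm`: same direction, `|s − s′|_∞ ≤ L^{j}` at both base points) and the same coordinate
slot. [cite: Balaban1984PropagatorsII, (2.137) p.247; Balaban1985BackgroundPropagators, (3.40) p.397] -/
def NearPairK (p q : XBK κ i) : Prop := p.1 ≠ q.1 ∧ Adm i p.1 q.1 ∧ p.2 = q.2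

/-- **THE η-SCALE PAIR WEIGHT ON BONDS** `((|s − s′|_∞ ∕ Lᵏ)^ε)⁻¹` (source sites; = the site weight `wEta` of the charted sources by `torusSupNorm_chartY_sub`).
[cite: Balaban1985BackgroundPropagators, (3.40) p.397; Balaban1984PropagatorsII, (2.67) p.234] -/
def wEtaK (ε : ℝ) (p q : XBK κ i) : ℝ := (((supDist p.1.src q.1.src : ℝ) / (nKT (toKT i) : ℝ)) ^ ε)⁻¹

omit [Fintype κ] in
/-- `0 ≤ wEtaK`. [cite: Balaban1985BackgroundPropagators, (3.40) p.397, bookkeeping] -/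
theorem wEtaK_nonneg (ε : ℝ) (p q : XBK κ i) : 0 ≤ wEtaK i ε p q :=
  inv_nonneg.2 (Real.rpow_nonneg (div_nonneg (Nat.cast_nonneg _) (Nat.cast_nonneg _)) _)

omit [Fintype κ] in
/-- the weight IS the site weight of the charted sources: `|s − s′|_∞ = |chart s − chart s′|_T`. [cite: Balaban1984PropagatorsII, (2.46) p.231, dictionary] -/
theorem wEtaK_eq (ε : ℝ) (p q : XBK κ i) :
    wEtaK i ε p q = ((torusSupNorm (toKT i).NB ((srcY i p).1 - (srcY i q).1) / (nKT (toKT i) : ℝ)) ^ ε)⁻¹ := by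
  rw [wEtaK, srcY, srcY, torusSupNorm_chartY_sub]

omit [Fintype κ] in
/-- a near pair has DISTINCT source sites (same direction, distinct bonds). [cite: Balaban1984PropagatorsII, (2.137) p.247, bookkeeping] -/
theorem src_ne_of_nearPairK {p q : XBK κ i} (h : NearPairK i p q) : p.1.src ≠ q.1.src := by
  intro hs
  apply h.1
  cases hp : p.1 with
  | mk s μ =>
    cases hq : q.1 with
    | mk s' μ' =>
      have hdir : p.1.dir = q.1.dir := h.2.1.1
      rw [hp, hq] at hdir hs
      simp only at hdir hs
      rw [hs, hdir]

omit [Fintype κ] in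
/-- … hence charted source sites at torus distance `≥ 1`. [cite: Balaban1983RegularityDecay, p.572, bookkeeping] -/
theorem torusSupNorm_srcY_pos {p q : XBK κ i} (h : NearPairK i p q) : 0 < torusSupNorm (toKT i).NB ((srcY i p).1 - (srcY i q).1) := by
  have hne : (srcY i p).1 ≠ (srcY i q).1 := fun he =>
    src_ne_of_nearPairK i h ((chartY i).injective (Subtype.ext he))
  exact lt_of_lt_of_le one_pos (one_le_torusSupNorm_sub (toKT i) (x := srcY i q) (x' := srcY i p) hne)

end Carrier

/-! ## §2 ★★ The smooth-partition Hölder class of the bond coordinate carrier -/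

section Class

variable (i : KIdx d ℓ hd hL b₀ b₁) [Fintype (geo9K i).Site]

open Classical in
/-- ★★ **THE SMOOTH-PARTITION HÖLDER CLASS `bHZK ε p` OF THE BOND COORDINATE CARRIER**: `BlockNorm.ofSmoothPartition` over `toB6 (geo9K i) R H` with `N y q := NearY i y (srcY q)`,
`P := NearPairK i`, `w := wEtaK i ε`, `W := Wscl i p` (`ε ≤ p`), `ζ := zetaOn i (srcY i)`, `Λ := CLip d ℓ` — every structural binder DISCHARGED; `cut y F = ζ_y(src)·F`,
**`κ = 1 + C_Lip(d, L)`** member-uniform. [cite: Balaban1985BackgroundPropagators, (3.40) p.397 + (3.43)–(3.45) p.398 + p.398 (remark after (3.47)); Balaban1984PropagatorsII, (2.51)–(2.52) p.232, (2.137) p.247] -/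
def bHZK {R : ℝ} {H : Prop} {ε p : ℝ} (hε0 : 0 ≤ ε) (hε1 : ε ≤ 1) (hεp : ε ≤ p) : BlockNorm (toB6 (geo9K i) R H) (XBK κ i → ℝ) :=
  BlockNorm.ofSmoothPartition (g := toB6 (geo9K i) R H) (fun y q => NearY i y (srcY i q)) (NearPairK i) (wEtaK i ε) (wEtaK_nonneg i ε) (Wscl i p)
    (Wscl_nonneg i p) (zetaOn i (srcY i)) (CLip d ℓ) (CLip_nonneg d ℓ) (fun q => sum_zetaOn_of_fintype i (srcY i) (toB6 (geo9K i) R H).fin q)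
    (zetaOn_nonneg i (srcY i)) (zetaOn_le_one i (srcY i)) (fun y q h => zetaOn_eq_zero_of_not_nearY i (srcY i) y q h)
    (fun y q q' _ hP => by
      rw [wEtaK_eq]
      exact (scaledWeight_mul_abs_zeta_sub_le i hε0 hε1 (Nat.cast_pos.2 (lt_of_lt_of_le Nat.zero_lt_one (one_le_nKT (toKT i)))) y (srcY i q) (srcY i q')
        (torusSupNorm_srcY_pos i hP)).trans (mul_le_mul_of_nonneg_left (Wscl_mono i hεp y) (CLip_nonneg d ℓ)))

variable {R : ℝ} {H : Prop} {ε p : ℝ} (hε0 : 0 ≤ ε) (hε1 : ε ≤ 1) (hεp : ε ≤ p)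

/-- ★ **THE CUTTING COST IS MEMBER-UNIFORM**: `κ = 1 + C_Lip(d, L)`. [cite: Balaban1984PropagatorsII, (2.52) p.232; Balaban1985BackgroundPropagators, (3.43) p.398] -/
theorem bHZK_κ : (bHZK (κ := κ) i (R := R) (H := H) hε0 hε1 hεp).κ = 1 + CLip d ℓ := rfl

/-- the cut-off is the multiplication by `ζ_y` at the source site. [cite: Balaban1985BackgroundPropagators, (3.43) p.398, bookkeeping] -/
theorem bHZK_cut_apply (y : IBondY i) (F : XBK κ i → ℝ) (q : XBK κ i) :
    (bHZK (κ := κ) i (R := R) (H := H) hε0 hε1 hεp).cut y F q = zeta i y (srcY i q) * F q := by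
  classical
  exact ofSmoothPartition_cut_apply _ _ _

/-- localisation at `y` = the bond vector vanishes at bonds whose source lies off `Δ̃(y)`. [cite: Balaban1985BackgroundPropagators, (3.44) p.398 + p.398 (remark after (3.47)), bookkeeping] -/
theorem bHZK_isLoc_iff (y : IBondY i) (F : XBK κ i → ℝ) :
    (bHZK (κ := κ) i (R := R) (H := H) hε0 hε1 hεp).IsLoc y F ↔ ∀ q : XBK κ i, ¬ NearY i y (srcY i q) → F q = 0 := by
  classical
  exact ofSmoothPartition_isLoc_iff _ _

open Classical in
/-- the local size: `(Lʲη)^{−p}·(sup over bonds sourced in Δ̃(y)) + (weighted admissible-pair part based in Δ̃(y))`. [cite: Balaban1985BackgroundPropagators, (3.39)–(3.40) p.397, bookkeeping] -/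
theorem bHZK_loc (y : IBondY i) (F : XBK κ i → ℝ) :
    (bHZK (κ := κ) i (R := R) (H := H) hε0 hε1 hεp).loc y F =
      Wscl i p y * (Size.ofSup (toB6 (geo9K i) R H) (fun (q : XBK κ i) (y : IBondY i) => NearY i y (srcY i q))).sz y F +
        (Size.ofPairs (toB6 (geo9K i) R H) (fun (q : XBK κ i) (y : IBondY i) => NearY i y (srcY i q)) (NearPairK i) (wEtaK i ε) (wEtaK_nonneg i ε)).sz y F := by
  classical
  exact ofSmoothPartition_loc _ _

/-! ## §3 Sharp localisation over the carrier block implies smooth localisation -/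

omit [Fintype κ] [Fintype (geo9K i).Site] in
/-- the block of a fine bond IS the block of its charted source site. [cite: Balaban1984PropagatorsII, (2.45) p.231, bookkeeping] -/
theorem blkV1_eq_blkOf_srcY (q : XBK κ i) : blkV1 i.hN i.D q.1 = blkOf i.D.toDomains (srcY i q) := rfl

/-- a bond vector supported over the fine bonds of the carrier block `β y` is localised at `y` in `bHZK`. [cite: Balaban1985BackgroundPropagators, p.398 (remark after (3.47): «supp J ⊂ Δ(y′)»), bookkeeping] -/
theorem bHZK_isLoc_of_blkV1 (y : IBondY i) (F : XBK κ i → ℝ) (hF : ∀ q : XBK κ i, blkV1 i.hN i.D q.1 ≠ β i.hN i.D i.hk y → F q = 0) :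
    (bHZK (κ := κ) i (R := R) (H := H) hε0 hε1 hεp).IsLoc y F := by
  rw [bHZK_isLoc_iff]
  intro q hq
  by_contra hne
  have hb : blkV1 i.hN i.D q.1 = β i.hN i.D i.hk y := by by_contra hb; exact hne (hF q hb)
  rw [blkV1_eq_blkOf_srcY] at hb
  exact hq (nearY_of_blkOf_eq i hb)

end Class

end Literature.MathematicalPhysics.QuantumFieldTheory.Balaban1983to89.B9SmoothHolderClassK
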